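import Mathlib
import Summits.NavierStokesRegularity.NavierStokesRegularity.Theorems.EulerZoomLiouvillePowerGaugeEulerLiouvilleCondenserShellCondenser

/-!
# (B″_g) THE SHELL CONDENSER, GAUGE FORM ON THE WINDOW `[ℓ, qℓ]` (nsreg-p2 g36 ROUND-46 «THE KINEMATIC CEILING» §1, plate t48-B″ —
gauge half)

Width piece for crux `EulerZoomLiouville.PowerGaugeEulerLiouville` (stmt-NavierStokesRegularity-19832), by name under LEAD 19832
(ns-typeII-p2 g13); seat ns-sfl-p1 g7, `--supports stmt-NavierStokesRegularity-19832 --as helper`.  Text = nsreg-p2 g36's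
`r46/Sketch46.lean` (sha16 7c4c548940e39666) Prop `NsregP2.R46.ShellCondenserGaugeForm` binder-for-binder (`E3` spelled out).

For `q > 1`, `0 < θ < 1` and the `A`-gauge constant `C_A` there is `R₁` such that for every globally Lipschitz `C¹` field, every
`ℓ ≥ R₁` and every `S > 0` bounding the Dirichlet energy of the shell `B(0,qℓ) ∩ {ℓ ≤ ‖x‖}`: a backward similarity orbit from
`‖y‖ < ℓ` reaching `‖·‖ ≥ qℓ` forces `‖DV(z)‖ ≥ exp(θ·2πγ²(q³−1)ℓ³/(3S))` at some `z ∈ B(0,qℓ)`.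
Proof (ROUND-46 §6 recipe): the static shell condenser (B″) `Condenser.shellCondenser_of` (p-file `…CondenserShellCondenser`) with
`ℓ₁ = ℓ`, `ℓ₂ = qℓ − 2`, `r = 1`, `R' = qℓ`, `η = δ = t`, `X = C_A(qℓ)^{1−2ρ} ≤ C_A qℓ` (`ρ ≥ 0`, `qℓ ≥ 1`); the crossings come
from the first exit of the orbit through the sphere `‖·‖ = qℓ − 2` (`exists_crossings_of_exit`: t42a `exists_firstHit_of_exit` +
`exists_anomalous_plane_of_exit`); the loss `t ∈ (0, 1/4]` is chosen by continuity at `t = 0` so that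
`(1−2t)²((1+(1−2t)(q−1))³−1) > θ(q³−1)` (`exists_shell_loss_parameter`), and `R₁ = max(1, 4/(q−1), 2/(t(q−1)),
√(2A₀/π)/(tγ), 2/(tγ))`, `A₀ = 2C_A q/(t(q−1))`, makes the smallness hypothesis of (B″) hold (`√(2A/π) ≤ √(2A₀/π) ≤ tγℓ`), the
cube `(ℓ+(1−t)(qℓ−2−ℓ))³ − ℓ³ ≥ ℓ³((1+(1−2t)(q−1))³ − 1)`, and the prefactor `tγℓ ≥ 2` (strictness).

* `exists_crossings_of_exit`, `exists_shell_loss_parameter`, `cube_window_lower_bound` — tools;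
* `shellCondenserGaugeForm` — `NsregP2.R46.ShellCondenserGaugeForm` VERBATIM.

HONEST FRAMING: real analysis in `ℝ³` (with a cut-off flow); nothing here proves the crux E (19832 OPEN), any door Target, or any
Navier–Stokes statement; no summit statement is touched. [folklore (length–area method); cite: ConstantinIgnatovaVicol2026Putative,
§3.4.1 for the setting]
-/

noncomputable section

open Set Filter Topology Metric Function MeasureTheory Real
open scoped RealInnerProductSpace

set_option linter.dupNamespace false

namespace Summit.NavierStokesRegularity.NavierStokesRegularity.Theorems.PowerGaugeEulerLiouville.Condenser

open Literature.Analysis Literature.Analysis.FluidPDE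

/-! ## Tools -/

/-- **Crossings from an exit.**  A backward similarity orbit of the cut-off flow (`‖DV‖ ≤ K`) from `‖y‖ < ℓ₁` reaching
`‖Ψ_L y‖ ≥ ℓ₂ ≥ ℓ₁ > 0` crosses, for `e` = the direction of its first exit through the sphere of radius `ℓ₂`, every plane
`⟪·,e⟫ = s`, `s ∈ [ℓ₁, ℓ₂]`, anomalously inside `B̄(0,ℓ₂)` (t42a `exists_firstHit_of_exit` + `exists_anomalous_plane_of_exit`).
[folklore; cite: ConstantinIgnatovaVicol2026Putative, §3.4.1 for the setting] -/
theorem exists_crossings_of_exit {γ : ℝ} {V : EuclideanSpace ℝ (Fin 3) → EuclideanSpace ℝ (Fin 3)} (hV : ContDiff ℝ 1 V)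
    {K : ℝ} (hK : ∀ y, ‖fderiv ℝ V y‖ ≤ K) {ℓ₁ ℓ₂ : ℝ} (hℓ₁ : 0 < ℓ₁) (hℓ : ℓ₁ ≤ ℓ₂)
    {y : EuclideanSpace ℝ (Fin 3)} (hy : ‖y‖ < ℓ₁) {L : ℝ} (hL : 0 ≤ L)
    (hexit : ℓ₂ ≤ ‖ODE.evolutionMap (fun _ : ℝ => selfSimilarTransport γ 0 V) 0 (-L) y‖) :
    ∃ e : EuclideanSpace ℝ (Fin 3), ‖e‖ = 1 ∧
      ∀ s ∈ Icc ℓ₁ ℓ₂, ∃ y₁ : EuclideanSpace ℝ (Fin 3), ⟪y₁, e⟫ = s ∧ ‖y₁‖ ≤ ℓ₂ ∧ γ * s ≤ ‖V y₁‖ := by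
  have hℓ₂ : 0 < ℓ₂ := hℓ₁.trans_le hℓ
  have hy₂ : ‖y‖ < ℓ₂ := hy.trans_le hℓ
  -- first exit through the sphere of radius `ℓ₂`
  obtain ⟨σ₁, hσ₁, hlt, heq⟩ := exists_firstHit_of_exit (γ := γ) hV hK hL hy₂ hexit
  set z : EuclideanSpace ℝ (Fin 3) := ODE.evolutionMap (fun _ : ℝ => selfSimilarTransport γ 0 V) 0 (-σ₁) y with hz
  set e : EuclideanSpace ℝ (Fin 3) := (ℓ₂)⁻¹ • z with he
  have he1 : ‖e‖ = 1 := by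
    rw [he, norm_smul, norm_inv, Real.norm_eq_abs, abs_of_pos hℓ₂, heq, inv_mul_cancel₀ hℓ₂.ne']
  refine ⟨e, he1, ?_⟩
  intro s hs
  have hys : ⟪y, e⟫ < s := by
    have h1 : ⟪y, e⟫ ≤ ‖y‖ * ‖e‖ := real_inner_le_norm y e
    rw [he1, mul_one] at h1
    linarith [hs.1]
  have hzs : s ≤ ⟪z, e⟫ := by
    have h1 : ⟪z, e⟫ = ℓ₂ := by
      rw [he, real_inner_smul_right, real_inner_self_eq_norm_sq, heq]
      field_simp
    rw [h1]; exact hs.2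
  obtain ⟨σ₂, hσ₂, heq₂, -, hV₂⟩ := exists_anomalous_plane_of_exit (γ := γ) hV hK he1 hσ₁.1.le hys hzs
  refine ⟨_, heq₂, ?_, hV₂⟩
  rcases hσ₂.2.lt_or_eq with hlt₂ | heq₂'
  · exact (hlt σ₂ ⟨hσ₂.1.le, hlt₂⟩).le
  · rw [heq₂']; exact heq.le

/-- Choice of the loss parameter of (B″_g): `f(t) = (1−2t)²((1+(1−2t)(q−1))³−1)` is continuous with `f(0) = q³ − 1 > θ(q³−1)`
(`q > 1`, `θ < 1`), so some `t ∈ (0, 1/4]` still has `f(t) > θ(q³−1)`. [folklore] -/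
theorem exists_shell_loss_parameter {q θ : ℝ} (hq : 1 < q) (hθ1 : θ < 1) :
    ∃ t : ℝ, 0 < t ∧ t ≤ 1 / 4 ∧ θ * (q ^ 3 - 1) < (1 - 2 * t) ^ 2 * ((1 + (1 - 2 * t) * (q - 1)) ^ 3 - 1) := by
  set f : ℝ → ℝ := fun t => (1 - 2 * t) ^ 2 * ((1 + (1 - 2 * t) * (q - 1)) ^ 3 - 1) with hf
  have hfc : Continuous f := by
    simp only [hf]
    fun_prop
  have hf0 : f 0 = q ^ 3 - 1 := by simp only [hf]; ring
  have hq3 : 0 < q ^ 3 - 1 := by nlinarith [pow_lt_pow_left₀ hq zero_le_one three_ne_zero]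
  have hlt0 : θ * (q ^ 3 - 1) < f 0 := by rw [hf0]; nlinarith
  have hev : ∀ᶠ t in 𝓝 (0 : ℝ), θ * (q ^ 3 - 1) < f t := hfc.continuousAt.eventually (lt_mem_nhds hlt0)
  obtain ⟨ε, hε, hball⟩ := Metric.eventually_nhds_iff.1 hev
  refine ⟨min (ε / 2) (1 / 4), by positivity, min_le_right _ _, ?_⟩
  have h := hball (y := min (ε / 2) (1 / 4)) (by
    rw [Real.dist_eq, sub_zero, abs_of_pos (by positivity)]
    exact (min_le_left _ _).trans_lt (by linarith))
  simpa only [hf] using h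

/-- The window cube bound: for `t(q−1)ℓ ≥ 2`, `0 < t ≤ 1/4`, `q > 1`, `ℓ > 0`,
`ℓ³((1+(1−2t)(q−1))³ − 1) ≤ (ℓ + (1−t)((qℓ−2) − ℓ))³ − ℓ³`. [folklore] -/
theorem cube_window_lower_bound {q t ℓ : ℝ} (hq : 1 < q) (ht : 0 < t) (ht4 : t ≤ 1 / 4) (hℓ : 0 < ℓ)
    (htqℓ : 2 ≤ t * (q - 1) * ℓ) :
    ℓ ^ 3 * ((1 + (1 - 2 * t) * (q - 1)) ^ 3 - 1) ≤ (ℓ + (1 - t) * ((q * ℓ - 2) - ℓ)) ^ 3 - ℓ ^ 3 := by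
  have hb0 : 0 ≤ ℓ * (1 + (1 - 2 * t) * (q - 1)) := by
    have : 0 ≤ 1 + (1 - 2 * t) * (q - 1) := by nlinarith
    positivity
  have hab : ℓ * (1 + (1 - 2 * t) * (q - 1)) ≤ ℓ + (1 - t) * ((q * ℓ - 2) - ℓ) := by nlinarith
  have h3 := pow_le_pow_left₀ hb0 hab 3
  have e : (ℓ * (1 + (1 - 2 * t) * (q - 1))) ^ 3 = ℓ ^ 3 * (1 + (1 - 2 * t) * (q - 1)) ^ 3 := by ring
  rw [e] at h3
  linarith

/-- Amplitude bookkeeping of (B″_g): with `X = C_A(qℓ)^{1−2ρ}`, `ρ ≥ 0`, `ℓ ≥ 1`, `(q−1)ℓ ≥ 4`, `t > 0`: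
`X/(t((qℓ−2)−ℓ)) ≤ 2C_A q/(t(q−1))`. [folklore] -/
theorem shell_amplitude_le {C_A q t ρ ℓ : ℝ} (hCA : 0 < C_A) (hq : 1 < q) (ht : 0 < t) (hρ : 0 ≤ ρ) (h1 : 1 ≤ ℓ)
    (h4 : 4 ≤ (q - 1) * ℓ) :
    C_A * (q * ℓ) ^ (1 - 2 * ρ) / (t * ((q * ℓ - 2) - ℓ)) ≤ 2 * C_A * q / (t * (q - 1)) := by
  have hℓ : 0 < ℓ := by linarith
  have hqℓ : 1 ≤ q * ℓ := by nlinarith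
  have hXle : C_A * (q * ℓ) ^ (1 - 2 * ρ) ≤ C_A * (q * ℓ) := by
    refine mul_le_mul_of_nonneg_left ?_ hCA.le
    calc (q * ℓ) ^ (1 - 2 * ρ) ≤ (q * ℓ) ^ (1 : ℝ) := Real.rpow_le_rpow_of_exponent_le hqℓ (by linarith)
      _ = q * ℓ := Real.rpow_one _
  have hden : 0 < t * ((q * ℓ - 2) - ℓ) := mul_pos ht (by nlinarith)
  rw [div_le_div_iff₀ hden (by nlinarith : 0 < t * (q - 1))]
  have h2 : (q - 1) * ℓ ≤ 2 * ((q * ℓ - 2) - ℓ) := by nlinarith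
  calc C_A * (q * ℓ) ^ (1 - 2 * ρ) * (t * (q - 1))
      ≤ C_A * (q * ℓ) * (t * (q - 1)) := by gcongr
    _ = C_A * q * t * ((q - 1) * ℓ) := by ring
    _ ≤ C_A * q * t * (2 * ((q * ℓ - 2) - ℓ)) := by gcongr
    _ = 2 * C_A * q * (t * ((q * ℓ - 2) - ℓ)) := by ring

/-! ## The shell condenser, gauge form -/

/-- **(B″_g) `NsregP2.R46.ShellCondenserGaugeForm`, binder-for-binder** (Sketch46 of nsreg-p2 g36, sha16 7c4c548940e39666, plate
t48-B″ gauge form; `E3` spelled out).  See the module docstring for the proof.  [folklore (length–area method);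
cite: ConstantinIgnatovaVicol2026Putative, §3.4.1 for the setting] -/
theorem shellCondenserGaugeForm :
    ∀ (γ ρ C_A q θ : ℝ), 0 < γ → 0 ≤ ρ → 0 < C_A → 1 < q → 0 < θ → θ < 1 →
      ∃ R₁ : ℝ, 0 < R₁ ∧
        ∀ (V : EuclideanSpace ℝ (Fin 3) → EuclideanSpace ℝ (Fin 3)) (K : ℝ), ContDiff ℝ 1 V →
          (∀ y, ‖fderiv ℝ V y‖ ≤ K) →
          ∀ ℓ S : ℝ, R₁ ≤ ℓ → 0 < S →
            (∫ x in ball (0 : EuclideanSpace ℝ (Fin 3)) (q * ℓ), ‖V x‖ ^ 2 ≤ C_A * (q * ℓ) ^ (1 - 2 * ρ)) →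
            (∫ x in ball (0 : EuclideanSpace ℝ (Fin 3)) (q * ℓ) ∩ {x : EuclideanSpace ℝ (Fin 3) | ℓ ≤ ‖x‖},
                ‖fderiv ℝ V x‖ ^ 2 ≤ S) →
            ∀ (y : EuclideanSpace ℝ (Fin 3)) (L : ℝ), 0 ≤ L → ‖y‖ < ℓ →
              q * ℓ ≤ ‖ODE.evolutionMap (fun _ : ℝ => selfSimilarTransport γ 0 V) 0 (-L) y‖ →
              ∃ z ∈ ball (0 : EuclideanSpace ℝ (Fin 3)) (q * ℓ),
                Real.exp (θ * (2 * Real.pi * γ ^ 2 * (q ^ 3 - 1) * ℓ ^ 3 / (3 * S))) ≤ ‖fderiv ℝ V z‖ := by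
  intro γ ρ C_A q θ hγ hρ hCA hq hθ hθ1
  have hπ : 0 < Real.pi := Real.pi_pos
  have hqm : 0 < q - 1 := by linarith
  -- the loss parameter `t` (= δ = η)
  obtain ⟨t, ht0, ht4, hμ⟩ := exists_shell_loss_parameter hq hθ1
  have ht1 : t < 1 := by linarith
  have ht2 : t < 1 / 2 := by linarith
  -- the amplitude constant and the threshold radius
  set A₀ : ℝ := 2 * C_A * q / (t * (q - 1)) with hA₀
  have hA₀pos : 0 < A₀ := by rw [hA₀]; positivity
  refine ⟨max 1 (max (4 / (q - 1)) (max (2 / (t * (q - 1))) (max (Real.sqrt (2 * A₀ / Real.pi) / (t * γ))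
      (2 / (t * γ))))), lt_max_of_lt_left one_pos, ?_⟩
  intro V K hV hK ℓ S hℓ hS hA hE y L hL hy hexit
  have h1 : 1 ≤ ℓ := (le_max_left _ _).trans hℓ
  have hℓpos : 0 < ℓ := by linarith
  have h4 : 4 ≤ (q - 1) * ℓ := by
    have h := ((le_max_left _ _).trans (le_max_right _ _)).trans hℓ
    rw [div_le_iff₀ hqm] at h
    linarith
  have htq : 2 ≤ t * (q - 1) * ℓ := by
    have h := ((le_max_left _ _).trans ((le_max_right _ _).trans (le_max_right _ _))).trans hℓ
    rw [div_le_iff₀ (by positivity)] at h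
    linarith
  have hsm : Real.sqrt (2 * A₀ / Real.pi) ≤ t * γ * ℓ := by
    have h := (((le_max_left _ _).trans (le_max_right _ _)).trans ((le_max_right _ _).trans (le_max_right _ _))).trans hℓ
    rw [div_le_iff₀ (by positivity)] at h
    linarith
  have htγℓ : 2 ≤ t * γ * ℓ := by
    have h := (((le_max_right _ _).trans (le_max_right _ _)).trans ((le_max_right _ _).trans (le_max_right _ _))).trans hℓ
    rw [div_le_iff₀ (by positivity)] at h
    linarith
  -- the window `[ℓ, qℓ − 2]`, disc radius `1`, outer radius `qℓ`
  set ℓ₂ : ℝ := q * ℓ - 2 with hℓ₂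
  have hℓℓ₂ : ℓ < ℓ₂ := by rw [hℓ₂]; nlinarith
  have hR' : ℓ₂ + 1 < q * ℓ := by rw [hℓ₂]; linarith
  have hX : 0 < C_A * (q * ℓ) ^ (1 - 2 * ρ) := mul_pos hCA (Real.rpow_pos_of_pos (by positivity) _)
  -- smallness of the outer-mean term
  have hAle : C_A * (q * ℓ) ^ (1 - 2 * ρ) / (t * (ℓ₂ - ℓ)) ≤ A₀ := by
    rw [hA₀, hℓ₂]; exact shell_amplitude_le hCA hq ht0 hρ h1 h4
  have hsmall : Real.sqrt (2 * (C_A * (q * ℓ) ^ (1 - 2 * ρ) / (t * (ℓ₂ - ℓ))) / Real.pi) / 1 ≤ t * (γ * ℓ) := by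
    rw [div_one]
    have h2 : Real.sqrt (2 * (C_A * (q * ℓ) ^ (1 - 2 * ρ) / (t * (ℓ₂ - ℓ))) / Real.pi) ≤
        Real.sqrt (2 * A₀ / Real.pi) := by
      apply Real.sqrt_le_sqrt
      exact div_le_div_of_nonneg_right (by linarith) hπ.le
    linarith
  -- the exit gives the crossings of every plane of the window inside `B̄(0, qℓ − 2)`
  have hexit' : ℓ₂ ≤ ‖ODE.evolutionMap (fun _ : ℝ => selfSimilarTransport γ 0 V) 0 (-L) y‖ :=
    le_trans (by rw [hℓ₂]; linarith) hexit
  obtain ⟨e, he1, hcross⟩ := exists_crossings_of_exit (γ := γ) hV hK hℓpos hℓℓ₂.le hy hL hexit'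
  -- contradiction with the envelope `‖DV‖ < exp(θ · …)` on `B(0, qℓ)`
  by_contra hcon
  push Not at hcon
  set G₀ : ℝ := Real.exp (θ * (2 * Real.pi * γ ^ 2 * (q ^ 3 - 1) * ℓ ^ 3 / (3 * S))) with hG₀
  have hG : ∀ z ∈ ball (0 : EuclideanSpace ℝ (Fin 3)) (q * ℓ), ‖fderiv ℝ V z‖ ≤ G₀ := fun z hz => (hcon z hz).le
  have hstat := shellCondenser_of hV he1 hγ hℓpos hℓℓ₂ one_pos hR' ht0 ht1 ht0 ht2 hX hS hA hE hG hsmall hcross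
  -- the exponent is at least the `θ`-exponent
  set D : ℝ := (ℓ + (1 - t) * (ℓ₂ - ℓ)) ^ 3 - ℓ ^ 3 with hD
  have hDlow : ℓ ^ 3 * ((1 + (1 - 2 * t) * (q - 1)) ^ 3 - 1) ≤ D := by
    rw [hD, hℓ₂]; exact cube_window_lower_bound hq ht0 ht4 hℓpos htq
  have hq3 : 0 < q ^ 3 - 1 := by nlinarith [pow_lt_pow_left₀ hq zero_le_one three_ne_zero]
  have hexpo : θ * (2 * Real.pi * γ ^ 2 * (q ^ 3 - 1) * ℓ ^ 3 / (3 * S)) ≤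
      2 * Real.pi * ((1 - 2 * t) * γ) ^ 2 * (D / (3 * S)) := by
    have hℓ3 : 0 < ℓ ^ 3 := by positivity
    have hγ2 : 0 < γ ^ 2 := by positivity
    have hkey : θ * (q ^ 3 - 1) * ℓ ^ 3 ≤ (1 - 2 * t) ^ 2 * D := by
      calc θ * (q ^ 3 - 1) * ℓ ^ 3 ≤ (1 - 2 * t) ^ 2 * ((1 + (1 - 2 * t) * (q - 1)) ^ 3 - 1) * ℓ ^ 3 :=
            mul_le_mul_of_nonneg_right hμ.le hℓ3.le
        _ = (1 - 2 * t) ^ 2 * (ℓ ^ 3 * ((1 + (1 - 2 * t) * (q - 1)) ^ 3 - 1)) := by ring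
        _ ≤ (1 - 2 * t) ^ 2 * D := mul_le_mul_of_nonneg_left hDlow (sq_nonneg _)
    have e1 : θ * (2 * Real.pi * γ ^ 2 * (q ^ 3 - 1) * ℓ ^ 3 / (3 * S)) =
        (2 * Real.pi * γ ^ 2 / (3 * S)) * (θ * (q ^ 3 - 1) * ℓ ^ 3) := by ring
    have e2 : 2 * Real.pi * ((1 - 2 * t) * γ) ^ 2 * (D / (3 * S)) =
        (2 * Real.pi * γ ^ 2 / (3 * S)) * ((1 - 2 * t) ^ 2 * D) := by ring
    rw [e1, e2]
    exact mul_le_mul_of_nonneg_left hkey (by positivity)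
  have hexp : G₀ ≤ Real.exp (2 * Real.pi * ((1 - 2 * t) * γ) ^ 2 * (D / (3 * S))) := by
    rw [hG₀]; exact Real.exp_le_exp.2 hexpo
  -- prefactor `tγℓ ≥ 2`: `2·exp(full) ≤ tγℓ·exp(full) ≤ G₀ ≤ exp(full)`, absurd
  have hpos := Real.exp_pos (2 * Real.pi * ((1 - 2 * t) * γ) ^ 2 * (D / (3 * S)))
  rw [div_one] at hstat
  have h2 : 2 * Real.exp (2 * Real.pi * ((1 - 2 * t) * γ) ^ 2 * (D / (3 * S))) ≤
      t * (γ * ℓ) * Real.exp (2 * Real.pi * ((1 - 2 * t) * γ) ^ 2 * (D / (3 * S))) :=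
    mul_le_mul_of_nonneg_right (by linarith) hpos.le
  linarith

end Summit.NavierStokesRegularity.NavierStokesRegularity.Theorems.PowerGaugeEulerLiouville.Condenser

end
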